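import Literature.NumberTheory.Transcendental.KZLogCalculusProofs
import Literature.NumberTheory.Transcendental.KZMellinFibres
import Literature.ModelTheory.ExponentialFields.SemialgebraicC1Cells
import Literature.NumberTheory.Transcendental.SemialgebraicMapsProofs
import HarnessLib

/-!
# `ContinuousCubification` (stmt-KontsevichZagierPeriods-17853) — line `SketchIdeator1`, stub `stub_cellFlattening`

Registered stub S3 of the line `SketchIdeator1` (Korobov damping) of the crux
`ContinuousCubification` (route UnfoldedStokes): **cell flattening.** A representation with
integrand `1` on a bounded open `ℚ`-`C¹` cell `C ⊆ ℝᴺ` (`IsC1SACell ℚ N N C`, van den Dries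
Ch. 7 (3.1)) is congruent modulo the moves of the Kontsevich–Zagier calculus (`KZ.relations`) to
a representation on the open unit cube `(0,1)ᴺ` whose integrand is continuous on the open cube
and bounded.

Proof. By induction on the construction of the cell we build a chart `Φ : (0,1)ⁿ → C`
(`exists_chart`): for a band `C = {(x, t) | x ∈ S, lo x < t < hi x}` over an open cell `S ⊆ ℝⁿ`
(boundedness of `C` forces both boundaries to be finite sections and `S` to be bounded) and a chart
`Φ₀ : (0,1)ⁿ → S` we take the graph straightening
`Φ(u', s) = (Φ₀ u', lo (Φ₀ u') + s · (hi − lo)(Φ₀ u'))`; it is `ℚ`-semialgebraic, injective, onto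
`C`, differentiable with block-triangular derivative whose determinant is
`(hi − lo)(Φ₀ u') · det Φ₀'(u')` (`LinearMap.det_of_snoc_init`) — positive, continuous on the open
cube and bounded by `(2R)ⁿ` if `C ⊆ B(0, R)`. One change-of-variables move (rule (2),
`KZ.changeOfVariablesRel`) along `Φ` carries `[C, 1]` to `[(0,1)ᴺ, J]`, `J = det Φ'`.
References: M. Kontsevich, D. Zagier, *Periods* (2001), §1.2, rule (2); L. van den Dries, *Tame
topology and o-minimal structures* (1998), Ch. 7 (3.1)–(3.2).
-/

noncomputable section

set_option linter.dupNamespace false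

namespace Summit.KontsevichZagierPeriods.KontsevichZagierPeriods.ContinuousCubificationLine

open MeasureTheory Set Filter
open scoped Topology
open Literature.NumberTheory.Transcendental
open Literature.NumberTheory.Transcendental.KZ
open Literature.ModelTheory.ExponentialFields (IsSemialgebraic IsC1SACell IsSACell IsC1On bandOver
  bandLower bandUpper snoc_mem_bandOver_iff snoc_mem_bandOver_iff_of_ne bandLower_zero
  bandUpper_last exists_continuousOn_snoc_mem_bandOver)

/-- The open unit cube `(0,1)ⁿ ⊆ ℝⁿ` (local notation). -/
local notation:max "𝓞 " n:max => (Set.pi (Set.univ : Set (Fin n)) (fun _ => Set.Ioo (0:ℝ) 1))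

/-- The open unit cube is `ℚ`-semialgebraic. [folklore] -/
theorem isSemialgebraic_openCube (n : ℕ) : IsSemialgebraic ℚ (𝓞 n) := by
  convert KZ.isSemialgebraic_box n using 1
  ext x
  simp only [mem_univ_pi, mem_setOf_eq]

/-- Membership in `(0,1)ⁿ⁺¹`: the first `n` coordinates lie in `(0,1)ⁿ` and the last one in
`(0,1)`. [folklore] -/
theorem mem_openCube_succ_iff {n : ℕ} {u : Fin (n + 1) → ℝ} :
    u ∈ 𝓞 (n + 1) ↔ Fin.init u ∈ 𝓞 n ∧ u (Fin.last n) ∈ Ioo (0:ℝ) 1 := by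
  simp only [mem_univ_pi, Fin.forall_fin_succ', Fin.init]

/-- A function `C¹` on an open set (in the sense of `IsC1On`: restriction of a `C¹` function on an
open neighbourhood) is differentiable at its points. [cite: Dries1998, Ch. 7 (3.1)] -/
theorem differentiableAt_of_isC1On {n : ℕ} {f : (Fin n → ℝ) → ℝ} {S : Set (Fin n → ℝ)}
    (h : IsC1On f S) (hS : IsOpen S) {x : Fin n → ℝ} (hx : x ∈ S) : DifferentiableAt ℝ f x := by
  obtain ⟨U, hU, hSU, F, hF, hFf⟩ := h
  have hFx : DifferentiableAt ℝ F x :=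
    (hF.differentiableOn_one x (hSU hx)).differentiableAt (hU.mem_nhds (hSU hx))
  exact hFx.congr_of_eventuallyEq
    (Filter.eventuallyEq_of_mem (hS.mem_nhds hx) fun y hy => (hFf hy).symm)

/-- **Derivative of the graph straightening**
`Φ(v) = (Φ₀ v', lo (Φ₀ v') + v_last · (hi − lo)(Φ₀ v'))`, `v' = init v`: if `Φ₀` has derivative
`A` at `init u` and `lo`, `hi` have derivatives `Dlo`, `Dhi` at `Φ₀ (init u)`, then `Φ` has at
`u` a derivative of the block-triangular shape
`w ↦ (A w', ℓ w' + c · w_last)` with `c = (hi − lo)(Φ₀ (init u))`, whose determinant is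
`c · det A` (`LinearMap.det_of_snoc_init`). [folklore] -/
theorem hasFDerivAt_flatten {n : ℕ} {Φ₀ : (Fin n → ℝ) → (Fin n → ℝ)}
    {A : (Fin n → ℝ) →L[ℝ] (Fin n → ℝ)} {lo hi : (Fin n → ℝ) → ℝ} {Dlo Dhi : (Fin n → ℝ) →L[ℝ] ℝ}
    {u : Fin (n + 1) → ℝ} (hΦ₀ : HasFDerivAt Φ₀ A (Fin.init u))
    (hlo : HasFDerivAt lo Dlo (Φ₀ (Fin.init u))) (hhi : HasFDerivAt hi Dhi (Φ₀ (Fin.init u))) :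
    ∃ L : (Fin (n + 1) → ℝ) →L[ℝ] (Fin (n + 1) → ℝ),
      L.det = (hi (Φ₀ (Fin.init u)) - lo (Φ₀ (Fin.init u))) * A.det ∧
      HasFDerivAt (fun v : Fin (n + 1) → ℝ => (Fin.snoc (Φ₀ (Fin.init v))
        (lo (Φ₀ (Fin.init v)) + v (Fin.last n) * (hi (Φ₀ (Fin.init v)) - lo (Φ₀ (Fin.init v)))) :
          Fin (n + 1) → ℝ)) L u := by
  let initL : (Fin (n + 1) → ℝ) →L[ℝ] (Fin n → ℝ) :=
    ContinuousLinearMap.pi fun i => ContinuousLinearMap.proj (Fin.castSucc i)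
  let lastL : (Fin (n + 1) → ℝ) →L[ℝ] ℝ := ContinuousLinearMap.proj (Fin.last n)
  have hinitL : ∀ w, initL w = Fin.init w := fun w => rfl
  have hlastL : ∀ w, lastL w = w (Fin.last n) := fun w => rfl
  set c : ℝ := hi (Φ₀ (Fin.init u)) - lo (Φ₀ (Fin.init u))
  let ℓ : (Fin n → ℝ) →L[ℝ] ℝ := (Dlo + u (Fin.last n) • (Dhi - Dlo)).comp A
  let row : (Fin (n + 1) → ℝ) →L[ℝ] ℝ := ℓ.comp initL + c • lastL
  have hrow : ∀ w, row w = Dlo (A (Fin.init w)) +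
      u (Fin.last n) * (Dhi (A (Fin.init w)) - Dlo (A (Fin.init w))) + c * w (Fin.last n) := by
    intro w
    simp [row, ℓ, hinitL, hlastL]
  let L : (Fin (n + 1) → ℝ) →L[ℝ] (Fin (n + 1) → ℝ) :=
    ContinuousLinearMap.pi
      (Fin.lastCases (motive := fun _ => (Fin (n + 1) → ℝ) →L[ℝ] ℝ) row
        (fun i => (ContinuousLinearMap.proj i).comp (A.comp initL)))
  have hL : ∀ w, L w = Fin.snoc (A (Fin.init w)) (row w) := by
    intro w
    funext i
    refine Fin.lastCases ?_ (fun j => ?_) i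
    · simp [L]
    · simp [L, hinitL]
  refine ⟨L, LinearMap.det_of_snoc_init (L : (Fin (n + 1) → ℝ) →ₗ[ℝ] (Fin (n + 1) → ℝ))
      (A : (Fin n → ℝ) →ₗ[ℝ] (Fin n → ℝ)) (ℓ : (Fin n → ℝ) →ₗ[ℝ] ℝ) c (fun w => by
        rw [ContinuousLinearMap.coe_coe, hL, hrow]
        simp [ℓ]), ?_⟩
  · -- derivative, coordinatewise
    have h1 : HasFDerivAt (fun x : Fin (n + 1) → ℝ => Fin.init x) initL u := initL.hasFDerivAt
    have hG : HasFDerivAt (fun x : Fin (n + 1) → ℝ => Φ₀ (Fin.init x)) (A.comp initL) u :=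
      hΦ₀.comp u h1
    rw [hasFDerivAt_pi']
    intro i
    refine Fin.lastCases ?_ (fun j => ?_) i
    · have hloG : HasFDerivAt (fun x : Fin (n + 1) → ℝ => lo (Φ₀ (Fin.init x)))
          (Dlo.comp (A.comp initL)) u := hlo.comp u hG
      have hhiG : HasFDerivAt (fun x : Fin (n + 1) → ℝ => hi (Φ₀ (Fin.init x)))
          (Dhi.comp (A.comp initL)) u := hhi.comp u hG
      have h := hloG.add ((hasFDerivAt_apply (Fin.last n) u).mul (hhiG.sub hloG))
      simp only [Fin.snoc_last]
      refine h.congr_fderiv (ContinuousLinearMap.ext fun w => ?_)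
      simp [hL, hrow, hinitL]
      ring
    · simp only [Fin.snoc_castSucc]
      have h := (hasFDerivAt_pi'.mp hG) j
      refine h.congr_fderiv (ContinuousLinearMap.ext fun w => ?_)
      simp [hL, hinitL]

/-- **The band step of the chart.** Let `S ⊆ ℝⁿ` be open, `lo < hi` continuous
`ℚ`-semialgebraic `C¹` functions on `S` with widths `hi − lo ≤ W`, and let
`Φ₀ : (0,1)ⁿ → S` be a `ℚ`-semialgebraic differentiable bijection with Jacobian determinant `J₀`,
`0 < J₀ ≤ B₀`, continuous and `ℚ`-semialgebraic. Then the graph straightening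
`Φ(u', s) = (Φ₀ u', lo (Φ₀ u') + s · (hi − lo)(Φ₀ u'))` is a `ℚ`-semialgebraic differentiable
bijection of `(0,1)ⁿ⁺¹` onto the band `{(x, t) | x ∈ S, lo x < t < hi x}` with Jacobian determinant
`J(u', s) = (hi − lo)(Φ₀ u') · J₀ u'`, `0 < J ≤ W · B₀`, continuous and `ℚ`-semialgebraic.
[folklore] -/
theorem exists_chart_band {n : ℕ} {S : Set (Fin n → ℝ)} (hSo : IsOpen S)
    {lo hi : (Fin n → ℝ) → ℝ} (hloc : ContinuousOn lo S) (hhic : ContinuousOn hi S)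
    (hlos : IsSemialgebraicFunOn ℚ S lo) (hhis : IsSemialgebraicFunOn ℚ S hi)
    (hlo1 : IsC1On lo S) (hhi1 : IsC1On hi S) (hlt : ∀ x ∈ S, lo x < hi x)
    {W : ℝ} (hW : ∀ x ∈ S, hi x - lo x ≤ W)
    {Φ₀ : (Fin n → ℝ) → (Fin n → ℝ)} {Φ₀' : (Fin n → ℝ) → ((Fin n → ℝ) →L[ℝ] (Fin n → ℝ))}
    {J₀ : (Fin n → ℝ) → ℝ} {B₀ : ℝ}
    (hsa₀ : IsSemialgebraicMapOn ℚ (𝓞 n) Φ₀) (hd₀ : ∀ u ∈ 𝓞 n, HasFDerivAt Φ₀ (Φ₀' u) u)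
    (hinj₀ : InjOn Φ₀ (𝓞 n)) (himg₀ : Φ₀ '' (𝓞 n) = S) (hdet₀ : ∀ u ∈ 𝓞 n, (Φ₀' u).det = J₀ u)
    (hJc₀ : ContinuousOn J₀ (𝓞 n)) (hJs₀ : IsSemialgebraicFunOn ℚ (𝓞 n) J₀)
    (hJB₀ : ∀ u ∈ 𝓞 n, 0 < J₀ u ∧ J₀ u ≤ B₀) :
    ∃ (Φ : (Fin (n + 1) → ℝ) → (Fin (n + 1) → ℝ))
      (Φ' : (Fin (n + 1) → ℝ) → ((Fin (n + 1) → ℝ) →L[ℝ] (Fin (n + 1) → ℝ)))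
      (J : (Fin (n + 1) → ℝ) → ℝ) (B : ℝ),
      IsSemialgebraicMapOn ℚ (𝓞 (n + 1)) Φ ∧ (∀ u ∈ 𝓞 (n + 1), HasFDerivAt Φ (Φ' u) u) ∧
      InjOn Φ (𝓞 (n + 1)) ∧
      Φ '' (𝓞 (n + 1)) =
        {z : Fin (n + 1) → ℝ | Fin.init z ∈ S ∧
          z (Fin.last n) ∈ Ioo (lo (Fin.init z)) (hi (Fin.init z))} ∧
      (∀ u ∈ 𝓞 (n + 1), (Φ' u).det = J u) ∧
      ContinuousOn J (𝓞 (n + 1)) ∧ IsSemialgebraicFunOn ℚ (𝓞 (n + 1)) J ∧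
      (∀ u ∈ 𝓞 (n + 1), 0 < J u ∧ J u ≤ B) := by
  have hinit : ∀ u ∈ 𝓞 (n + 1), Fin.init u ∈ 𝓞 n := fun u hu => (mem_openCube_succ_iff.mp hu).1
  have hmaps₀ : MapsTo Φ₀ (𝓞 n) S := fun v hv => himg₀ ▸ mem_image_of_mem Φ₀ hv
  have hy : ∀ u ∈ 𝓞 (n + 1), Φ₀ (Fin.init u) ∈ S := fun u hu => hmaps₀ (hinit u hu)
  have hΦ₀c : ContinuousOn Φ₀ (𝓞 n) := fun v hv => (hd₀ v hv).continuousAt.continuousWithinAt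
  have hO : IsSemialgebraic ℚ (𝓞 (n + 1)) := isSemialgebraic_openCube (n + 1)
  have hOsub : 𝓞 (n + 1) ⊆ {z | Fin.init z ∈ 𝓞 n} := hinit
  -- the chart and its Jacobian
  set Φ : (Fin (n + 1) → ℝ) → (Fin (n + 1) → ℝ) := fun v => Fin.snoc (Φ₀ (Fin.init v))
    (lo (Φ₀ (Fin.init v)) + v (Fin.last n) * (hi (Φ₀ (Fin.init v)) - lo (Φ₀ (Fin.init v))))
    with hΦ
  set J : (Fin (n + 1) → ℝ) → ℝ := fun v =>
    (hi (Φ₀ (Fin.init v)) - lo (Φ₀ (Fin.init v))) * J₀ (Fin.init v) with hJ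
  have hΦinit : ∀ v, Fin.init (Φ v) = Φ₀ (Fin.init v) := fun v => by simp [hΦ]
  have hΦlast : ∀ v, Φ v (Fin.last n) =
      lo (Φ₀ (Fin.init v)) + v (Fin.last n) * (hi (Φ₀ (Fin.init v)) - lo (Φ₀ (Fin.init v))) := by
    simp [hΦ]
  -- derivative
  have key : ∀ u : Fin (n + 1) → ℝ, ∃ L : (Fin (n + 1) → ℝ) →L[ℝ] (Fin (n + 1) → ℝ),
      u ∈ 𝓞 (n + 1) → L.det = J u ∧ HasFDerivAt Φ L u := by
    intro u
    by_cases hu : u ∈ 𝓞 (n + 1)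
    · obtain ⟨L, hLdet, hL⟩ := hasFDerivAt_flatten (hd₀ _ (hinit u hu))
        (differentiableAt_of_isC1On hlo1 hSo (hy u hu)).hasFDerivAt
        (differentiableAt_of_isC1On hhi1 hSo (hy u hu)).hasFDerivAt
      refine ⟨L, fun _ => ⟨?_, hL⟩⟩
      rw [hLdet, hdet₀ _ (hinit u hu)]
    · exact ⟨0, fun h => absurd h hu⟩
  choose Φ' hΦ' using key
  -- semialgebraicity of the pieces on the cube
  have hloO : IsSemialgebraicFunOn ℚ (𝓞 (n + 1)) (fun v => lo (Φ₀ (Fin.init v))) :=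
    (IsSemialgebraicFunOn.comp_isSemialgebraicMapOn_holds hlos hsa₀ hmaps₀).comp_init_mono hO hOsub
  have hhiO : IsSemialgebraicFunOn ℚ (𝓞 (n + 1)) (fun v => hi (Φ₀ (Fin.init v))) :=
    (IsSemialgebraicFunOn.comp_isSemialgebraicMapOn_holds hhis hsa₀ hmaps₀).comp_init_mono hO hOsub
  have hlastO : IsSemialgebraicFunOn ℚ (𝓞 (n + 1)) (fun v => v (Fin.last n)) :=
    Literature.NumberTheory.Transcendental.isSemialgebraicFunOn_apply hO (Fin.last n)
  have hJ₀O : IsSemialgebraicFunOn ℚ (𝓞 (n + 1)) (fun v => J₀ (Fin.init v)) :=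
    hJs₀.comp_init_mono hO hOsub
  refine ⟨Φ, Φ', J, W * B₀, ?_, fun u hu => ((hΦ' u) hu).2, ?_, ?_, fun u hu => ((hΦ' u) hu).1,
    ?_, ?_, ?_⟩
  · -- semialgebraic map
    refine IsSemialgebraicMapOn.of_forall hO fun i => ?_
    refine Fin.lastCases ?_ (fun i' => ?_) i
    · exact (IsSemialgebraicFunOn.add_holds hloO (IsSemialgebraicFunOn.mul_holds hlastO
        (IsSemialgebraicFunOn.sub_holds hhiO hloO))).congr fun v _ => by simp [hΦ]
    · exact (((isSemialgebraicMapOn_iff_forall_holds (isSemialgebraic_openCube n)).mp hsa₀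
        i').comp_init_mono hO hOsub).congr fun v _ => by simp [hΦ]
  · -- injective
    intro u hu v hv huv
    have h1 : Φ₀ (Fin.init u) = Φ₀ (Fin.init v) := by rw [← hΦinit, ← hΦinit, huv]
    have h2 : Fin.init u = Fin.init v := hinj₀ (hinit u hu) (hinit v hv) h1
    have h3 := congrFun huv (Fin.last n)
    rw [hΦlast, hΦlast, h2] at h3
    have hw : 0 < hi (Φ₀ (Fin.init v)) - lo (Φ₀ (Fin.init v)) := sub_pos.mpr (hlt _ (hy v hv))
    have h4 : u (Fin.last n) = v (Fin.last n) := mul_right_cancel₀ hw.ne' (add_left_cancel h3)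
    rw [← Fin.snoc_init_self u, ← Fin.snoc_init_self v, h2, h4]
  · -- image
    ext z
    constructor
    · rintro ⟨u, hu, rfl⟩
      have hyu := hy u hu
      have hw : 0 < hi (Φ₀ (Fin.init u)) - lo (Φ₀ (Fin.init u)) := sub_pos.mpr (hlt _ hyu)
      obtain ⟨hs0, hs1⟩ := (mem_openCube_succ_iff.mp hu).2
      refine ⟨by rw [hΦinit]; exact hyu, ?_, ?_⟩
      · rw [hΦinit, hΦlast]
        exact lt_add_of_pos_right _ (mul_pos hs0 hw)
      · rw [hΦinit, hΦlast]
        have := mul_lt_of_lt_one_left hw hs1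
        linarith
    · rintro ⟨hzS, ht⟩
      obtain ⟨u₀, hu₀, hu₀x⟩ : Fin.init z ∈ Φ₀ '' (𝓞 n) := by rw [himg₀]; exact hzS
      have hw : 0 < hi (Fin.init z) - lo (Fin.init z) := sub_pos.mpr (hlt _ hzS)
      set s : ℝ := (z (Fin.last n) - lo (Fin.init z)) / (hi (Fin.init z) - lo (Fin.init z)) with hs
      have hs0 : 0 < s := div_pos (sub_pos.mpr ht.1) hw
      have hs1 : s < 1 := (div_lt_one hw).mpr (by linarith [ht.2])
      have hus : (Fin.snoc u₀ s : Fin (n + 1) → ℝ) ∈ 𝓞 (n + 1) := by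
        rw [mem_openCube_succ_iff, Fin.init_snoc, Fin.snoc_last]; exact ⟨hu₀, hs0, hs1⟩
      refine ⟨Fin.snoc u₀ s, hus, ?_⟩
      have hval : lo (Fin.init z) + s * (hi (Fin.init z) - lo (Fin.init z)) = z (Fin.last n) := by
        rw [hs, div_mul_cancel₀ _ hw.ne']
        ring
      simp only [hΦ, Fin.init_snoc, Fin.snoc_last, hu₀x, hval]
      exact Fin.snoc_init_self z
  · -- continuity of the Jacobian
    have hic : ContinuousOn (fun v : Fin (n + 1) → ℝ => Fin.init v) (𝓞 (n + 1)) :=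
      continuous_id.finInit.continuousOn
    have hGc : ContinuousOn (fun v : Fin (n + 1) → ℝ => Φ₀ (Fin.init v)) (𝓞 (n + 1)) :=
      hΦ₀c.comp hic hinit
    exact ((hhic.comp hGc hy).sub (hloc.comp hGc hy)).mul (hJc₀.comp hic hinit)
  · -- semialgebraicity of the Jacobian
    exact (IsSemialgebraicFunOn.mul_holds (IsSemialgebraicFunOn.sub_holds hhiO hloO) hJ₀O).congr
      fun v _ => by simp [hJ]
  · -- positivity and bound
    intro u hu
    have hyu := hy u hu
    have hw : 0 < hi (Φ₀ (Fin.init u)) - lo (Φ₀ (Fin.init u)) := sub_pos.mpr (hlt _ hyu)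
    obtain ⟨hJ0, hJB⟩ := hJB₀ _ (hinit u hu)
    exact ⟨mul_pos hw hJ0, mul_le_mul (hW _ hyu) hJB hJ0.le (hw.le.trans (hW _ hyu))⟩

/-- **Charts of bounded open `C¹` cells.** A bounded open `ℚ`-`C¹` cell `C ⊆ ℝⁿ`
(`IsC1SACell ℚ n n C`) is the image of the open unit cube `(0,1)ⁿ` under a `ℚ`-semialgebraic
injective map `Φ`, differentiable at every point of the cube, whose Jacobian determinant `J` is
positive, bounded, continuous and `ℚ`-semialgebraic on the open cube (iterated graph
straightening, `exists_chart_band`; a bounded band has two finite boundary sections and a bounded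
base). [cite: Dries1998, Ch. 7 (3.1)] -/
theorem exists_chart {n d : ℕ} {C : Set (Fin n → ℝ)} (h : IsC1SACell ℚ n d C) :
    d = n → Bornology.IsBounded C →
      ∃ (Φ : (Fin n → ℝ) → (Fin n → ℝ)) (Φ' : (Fin n → ℝ) → ((Fin n → ℝ) →L[ℝ] (Fin n → ℝ)))
        (J : (Fin n → ℝ) → ℝ) (B : ℝ),
        IsSemialgebraicMapOn ℚ (𝓞 n) Φ ∧ (∀ u ∈ 𝓞 n, HasFDerivAt Φ (Φ' u) u) ∧
        InjOn Φ (𝓞 n) ∧ Φ '' (𝓞 n) = C ∧ (∀ u ∈ 𝓞 n, (Φ' u).det = J u) ∧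
        ContinuousOn J (𝓞 n) ∧ IsSemialgebraicFunOn ℚ (𝓞 n) J ∧
        (∀ u ∈ 𝓞 n, 0 < J u ∧ J u ≤ B) := by
  induction h with
  | zero =>
    intro _ _
    have hO : ∀ u : Fin 0 → ℝ, u ∈ 𝓞 0 := fun u => mem_univ_pi.mpr fun i => i.elim0
    have hOs : IsSemialgebraic ℚ (𝓞 0) := isSemialgebraic_openCube 0
    refine ⟨id, fun _ => ContinuousLinearMap.id ℝ _, fun _ => 1, 1, isSemialgebraicMapOn_id hOs,
      fun u _ => hasFDerivAt_id u, injOn_id _, ?_, fun u _ => ?_, continuousOn_const, ?_,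
      fun _ _ => ⟨one_pos, le_rfl⟩⟩
    · rw [image_id, eq_univ_iff_forall]; exact hO
    · show LinearMap.det _ = 1
      rw [ContinuousLinearMap.coe_id, LinearMap.det_id]
    · exact (isSemialgebraicFunOn_ratCast hOs 1).congr fun _ _ => by push_cast; rfl
  | graph hS _ _ _ _ =>
    intro hd
    have := hS.isSACell.le
    omega
  | @band n d l S ξ j hS hξc hξs hξ1 hmono ih =>
    intro hd hb
    have hdn : d = n := by omega
    have hSo : IsOpen S := hS.isSACell.isOpen hdn
    obtain ⟨R, hR0, hCR⟩ := hb.subset_closedBall_lt 0 0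
    -- coordinates of points of the band are bounded by `R`
    have hcoord : ∀ z ∈ bandOver S ξ j, ∀ i, |z i| ≤ R := fun z hz i =>
      (Real.norm_eq_abs _).symm.trans_le
        ((norm_le_pi_norm z i).trans (mem_closedBall_zero_iff.mp (hCR hz)))
    -- a section through the band, a point of the base
    obtain ⟨m, -, hm⟩ := exists_continuousOn_snoc_mem_bandOver hξc hmono j
    obtain ⟨x₀, hx₀⟩ := hS.isSACell.nonempty
    have hmx := hm x₀ hx₀
    rw [snoc_mem_bandOver_iff] at hmx
    -- the band is an inner one
    have h0 : j ≠ 0 := by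
      intro hj
      have hlow : bandLower ξ j x₀ < ↑(min (m x₀) (-(R + 1))) := by
        rw [hj, bandLower_zero]
        exact EReal.bot_lt_coe _
      have h1 := hcoord _ (snoc_mem_bandOver_iff.mpr ⟨hx₀, hlow,
        lt_of_le_of_lt (EReal.coe_le_coe_iff.mpr (min_le_left _ _)) hmx.2.2⟩) (Fin.last n)
      rw [Fin.snoc_last] at h1
      linarith [min_le_right (m x₀) (-(R + 1)), neg_le_abs (min (m x₀) (-(R + 1)))]
    have hl : j ≠ Fin.last l := by
      intro hj
      have hup : (↑(max (m x₀) (R + 1)) : EReal) < bandUpper ξ j x₀ := by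
        rw [hj, bandUpper_last]
        exact EReal.coe_lt_top _
      have h1 := hcoord _ (snoc_mem_bandOver_iff.mpr ⟨hx₀,
        lt_of_lt_of_le hmx.2.1 (EReal.coe_le_coe_iff.mpr (le_max_left _ _)), hup⟩) (Fin.last n)
      rw [Fin.snoc_last] at h1
      linarith [le_max_right (m x₀) (R + 1), le_abs_self (max (m x₀) (R + 1))]
    -- the two boundary sections `lo = ξ (j - 1) < hi = ξ j`
    have hC : bandOver S ξ j = {z : Fin (n + 1) → ℝ | Fin.init z ∈ S ∧ z (Fin.last n) ∈
        Ioo (ξ (j.pred h0) (Fin.init z)) (ξ (j.castPred hl) (Fin.init z))} := by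
      ext z
      rw [mem_setOf_eq, ← snoc_mem_bandOver_iff_of_ne h0 hl, Fin.snoc_init_self]
    have hlt : ∀ x ∈ S, ξ (j.pred h0) x < ξ (j.castPred hl) x := fun x hx => hmono x hx (by
      rw [Fin.lt_def, Fin.val_pred, Fin.coe_castPred]
      have : (j : ℕ) ≠ 0 := fun h => h0 (Fin.ext h)
      omega)
    -- fibres lie in `[-R, R]`: widths `≤ 2R`, and the base is bounded
    have hfib : ∀ x ∈ S, ∀ t ∈ Ioo (ξ (j.pred h0) x) (ξ (j.castPred hl) x),
        (Fin.snoc x t : Fin (n + 1) → ℝ) ∈ bandOver S ξ j :=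
      fun x hx t ht => (snoc_mem_bandOver_iff_of_ne h0 hl).mpr ⟨hx, ht⟩
    have hW : ∀ x ∈ S, ξ (j.castPred hl) x - ξ (j.pred h0) x ≤ 2 * R := by
      intro x hx
      have hsub : Ioo (ξ (j.pred h0) x) (ξ (j.castPred hl) x) ⊆ Icc (-R) R := fun t ht => by
        have h := hcoord _ (hfib x hx t ht) (Fin.last n)
        rw [Fin.snoc_last] at h
        exact abs_le.mp h
      have hcl : Icc (ξ (j.pred h0) x) (ξ (j.castPred hl) x) ⊆ Icc (-R) R := by
        rw [← closure_Ioo (hlt x hx).ne]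
        exact closure_minimal hsub isClosed_Icc
      linarith [(hcl (left_mem_Icc.mpr (hlt x hx).le)).1, (hcl (right_mem_Icc.mpr (hlt x hx).le)).2]
    have hSb : Bornology.IsBounded S := by
      refine (Metric.isBounded_closedBall (x := (0 : Fin n → ℝ)) (r := R)).subset fun x hx => ?_
      rw [mem_closedBall_zero_iff, pi_norm_le_iff_of_nonneg hR0.le]
      intro i
      obtain ⟨t, ht⟩ := exists_between (hlt x hx)
      have h := hcoord _ (hfib x hx t ht) (Fin.castSucc i)
      rwa [Fin.snoc_castSucc, ← Real.norm_eq_abs] at h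
    -- the chart of the base and the band step
    obtain ⟨Φ₀, Φ₀', J₀, B₀, hsa₀, hd₀, hinj₀, himg₀, hdet₀, hJc₀, hJs₀, hJB₀⟩ := ih hdn hSb
    obtain ⟨Φ, Φ', J, B, h⟩ := exists_chart_band hSo (hξc _) (hξc _) (hξs _) (hξs _) (hξ1 _)
      (hξ1 _) hlt hW hsa₀ hd₀ hinj₀ himg₀ hdet₀ hJc₀ hJs₀ hJB₀
    rw [hC]
    exact ⟨Φ, Φ', J, B, h⟩

/-- **Registered stub `stub_cellFlattening` (S3, cell flattening).** A representation with
integrand `1` on a bounded open `ℚ`-`C¹` cell `C ⊆ ℝᴺ` is congruent modulo the moves of the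
Kontsevich–Zagier calculus to a representation on the open unit cube `(0,1)ᴺ` whose integrand is
continuous on the open cube and bounded: one change-of-variables move (rule (2)) along the chart
`Φ : (0,1)ᴺ → C` of `exists_chart`, the new integrand being its Jacobian determinant.
[cite: KontsevichZagier2001, §1.2] -/
theorem stub_cellFlattening :
    ∀ (N : ℕ) (R : IntegralRep N), IsC1SACell ℚ N N R.domain → Bornology.IsBounded R.domain →
      (∀ z ∈ R.domain, R.integrand z = 1) →
      ∃ (r : IntegralRep N) (B : ℝ), r.domain = Set.pi Set.univ (fun _ : Fin N => Set.Ioo (0:ℝ) 1) ∧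
        ContinuousOn r.integrand (Set.pi Set.univ (fun _ : Fin N => Set.Ioo (0:ℝ) 1)) ∧
        (∀ u ∈ Set.pi Set.univ (fun _ : Fin N => Set.Ioo (0:ℝ) 1), |r.integrand u| ≤ B) ∧
        of R - of r ∈ relations := by
  intro N R hC hb h1
  obtain ⟨Φ, Φ', J, B, hsa, hd, hinj, himg, hdet, hJc, hJs, hJB⟩ := exists_chart hC rfl hb
  have habs : ∀ u ∈ 𝓞 N, |J u| = J u := fun u hu => abs_of_pos (hJB u hu).1
  -- the representation `[(0,1)ᴺ, J]`
  have hOm : MeasurableSet (𝓞 N) := MeasurableSet.univ_pi fun _ => measurableSet_Ioo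
  have hJi : IntegrableOn J (𝓞 N) := by
    refine ⟨hJc.aestronglyMeasurable hOm,
      HasFiniteIntegral.restrict_of_bounded (C := B) (by rw [volume_pi_pi]; simp) ?_⟩
    exact (ae_restrict_mem hOm).mono fun u hu => by
      rw [Real.norm_eq_abs, habs u hu]
      exact (hJB u hu).2
  let r : IntegralRep N := ⟨𝓞 N, J, isSemialgebraic_openCube N, hJs, hJi⟩
  refine ⟨r, B, rfl, hJc, fun u hu => (habs u hu).symm ▸ (hJB u hu).2, ?_⟩
  -- one change-of-variables move along `Φ`
  have hmove : of r - of R ∈ relations := by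
    refine changeOfVariablesRel_subset_relations ⟨N, r, R, Φ, Φ', hsa,
      fun u hu => (hd u hu).hasFDerivWithinAt, hinj, himg.symm, fun u hu => ?_, rfl⟩
    have hΦu : Φ u ∈ R.domain := himg ▸ mem_image_of_mem Φ hu
    show J u = R.integrand (Φ u) * |(Φ' u).det|
    rw [h1 _ hΦu, hdet u hu, habs u hu, one_mul]
  rw [← neg_sub]
  exact relations.neg_mem hmove

end Summit.KontsevichZagierPeriods.KontsevichZagierPeriods.ContinuousCubificationLine

end
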